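/-
Copyright (c) 2026. All rights reserved.
Released under Apache 2.0 license as described in the file LICENSE.
Authors: abc-iut cell, prover seat abc-iut-f-066 (gen 8; row «F3081 BUILD r1» B1, abc-iut-L4-lead m211/m212), over
abc-iut-f-101's relative-lift data (`DiagramRelativeFamilies.lean`), abc-iut-L4-t5's embeddings / sieves / lifting pairs
(`DiagramPathEmbeddings.lean`) and abc-iut-f-102's identification `extend_eq_comapAlong` (`LogFrobeniusRealisesSufficiency.lean`)
— every input consumed BY NAME; nothing of those files is restated.
-/
import Literature.AnabelianGeometry.AbsoluteAnabelian.LogFrobeniusRealisesSufficiency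
import Literature.AnabelianGeometry.AbsoluteAnabelian.DiagramPathEmbeddings
import HarnessLib

/-!
# [AbsTopIII] Cor 5.5 (iii), last sentence on `D•⊢`: the relative-lift datum of the `TS`-observables `S_log_v` at the pivots `𝒩_v`

S. Mochizuki, *Topics in absolute anabelian geometry III: global reconstruction algorithms* [MochizukiAbsTopIII2015];
locators `p.N` = pages of the author's manuscript (`paper:url-5493eb38cbb7`), read on the page: Cor 5.5 (iii) p. 131
("the families of homotopies that constitute `S_log` and `S_log⊞` are compatible with one another as well as with the
families of homotopies that constitute the core and telecore structures of (i), (ii)"), Def 3.5 (ii)/(iii) p. 75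
(families of homotopies; observables), §0 p. 26 (saturated sets of co-verticial pairs).

DEFINITION file (carrier-free bookkeeping over the frozen interface `LogFrobeniusSetting`; no `Prop`-valued reading of a
printed sentence is introduced).  abc-iut-L4-t3 typed the last sentence of Cor 5.5 (iii) on `D•⊢` as
`Cor55ObservablesCompatible T` (FACT-LIST F-3081): ONE family `K` on `D•⊢` realising the three cores and the `S_log⊞_v`
(`RealisesCor55Families K`, abc-iut-f-102's THEOREM B: `K₁ := relFamily (realisesRelLifts …)`, pivots `ℰ•`, `An•[𝒳]`, `ℰ•`
and the `𝒩⊞_v`) AND containing, at every `v`, an observable `S_log_v` (observation vertex `𝒩_v`).  `K₁` has no boundary pair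
INTO `𝒩_v` other than forget-whiskered `ι⊞`-chains, so the `𝒩_v` must become pivots of their own.  This file builds that
second relative-lift datum, GENERICALLY in the `TS`-observable families `Hts v` (families of homotopies on the presentation
`D•_{≤2} ∪ {𝒩⊞_v} ∪ {𝒩_v}` = `logDiagramTS v`):

* §1 `Γ⃗_{D•_{≤2} ∪ {𝒩⊞_v} ∪ {𝒩_v}} ↪ Γ⃗_{D•⊢}` (abc-iut-L4-t3's `embExt (InPortionThree v) (𝒩_v)`) is a graph EMBEDDING and a
  SIEVE (`graphEmbedding_embExt_nv`, `isSieve_embExt_nv`: nothing enters the portion from outside), and `D•⊢` has no arrow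
  between two `𝒩_v`'s (`eq_of_path_nv_nv`);
* §2 the datum `tsRelLifts Hts : L.diagram.RelLifts` — pivots `W := {𝒩_v}`, related pairs at `𝒩_v` := abc-iut-L4-t5's lifting
  pairs (`liftE`) of `Hts v` read on `D•⊢` through `extend_eq_comapAlong`, homotopies := `liftη`; the four laws of Def 3.5 (ii)
  are abc-iut-L4-t5's `liftη_self` / `lift_trans` / `lift_precomp` and the vacuous post-composition (no path `𝒩_v → 𝒩_{v'}`);
* §3 `tsRelLifts_rel_of_mem` / `tsRelLifts_θ_heq_of_mem`: every boundary pair of `Hts v` is, read on `D•⊢`, a related pair at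
  the pivot `𝒩_v` with the SAME homotopy — the input of the `CompatibleIn` clause of F-3081.

Downstream (this seat's B2/B3): the UNION (abc-iut-f-101's `RelLifts.union`) with abc-iut-f-102's `realisesRelLifts` and the
closing of F-3081.  HONEST LABEL: MODEL-LEVEL bookkeeping over OUR typed interface; refereed pre-IUT material; nothing here
bears on [IUTchIII] Cor. 3.12; no side taken; typed ≠ proved.
-/

set_option autoImplicit false

universe u

open CategoryTheory Quiver

namespace Literature.AnabelianGeometry.AbsoluteAnabelian

namespace LogFrobeniusSetting

open DiagramOfCategories

variable {Vmod : Type u} {isArc : Vmod → Bool} (L : LogFrobeniusSetting Vmod isArc)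

/-! ## §0. Bookkeeping -/

section Helpers

/-- heterogeneous equality of natural transformations from componentwise `eqToHom`-conjugation along equal functors
(bookkeeping). [folklore] -/
private theorem natTrans_heq_of_app_conj {A B : Type*} [Category A] [Category B] {F G F' G' : A ⥤ B} (hF : F = F') (hG : G = G')
    {α : F ⟶ G} {β : F' ⟶ G'}
    (h : ∀ x, α.app x = eqToHom (Functor.congr_obj hF x) ≫ β.app x ≫ eqToHom (Functor.congr_obj hG x).symm) : HEq α β := by
  subst hF hG
  apply heq_of_eq
  ext x
  simpa using h x

/-- whiskering on the right by a functor equal to the identity does nothing, heterogeneously (bookkeeping). [folklore] -/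
private theorem heq_whiskerRight_of_eq_id {A B : Type*} [Category A] [Category B] {F G : A ⥤ B} (α : F ⟶ G) {T : B ⥤ B}
    (hT : T = 𝟭 B) : HEq (Functor.whiskerRight α T) α := by
  subst hT
  exact heq_of_eq (NatTrans.ext (funext fun _ => rfl))

end Helpers

/-! ## §1. The portion `D•_{≤2} ∪ {𝒩⊞_v}` and its observation vertex `𝒩_v` inside `Γ⃗_{D•⊢}` -/

section Graph

variable (v : Vmod)

/-- Nothing enters the portion `D•_{≤2} ∪ {𝒩⊞_v}` from outside: the source of an arrow of `D•⊢` into a vertex of the portion is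
a vertex of the portion. [cite: MochizukiAbsTopIII2015, Cor 5.5 p. 130] -/
theorem inPortionThree_of_edge {c b : DVertex Vmod isArc} (e : DEdge isArc c b) (hb : InPortionThree (isArc := isArc) v b) :
    InPortionThree (isArc := isArc) v c := by
  cases e
  case log n => exact row1_mem_portion v _
  case toCore n => exact row1_mem_portion v _
  case lam w ν hν => exact core_mem_portion v
  all_goals
    rcases hb with ⟨hh, hr⟩ | h
    · simp [DVertex.IsHolomorphic, DVertex.row] at hh hr
    · cases h

/-- … hence the source of a PATH of `D•⊢` into a vertex of the portion is a vertex of the portion.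
[cite: MochizukiAbsTopIII2015, Cor 5.5 p. 130] -/
theorem inPortionThree_of_path {c b : DVertex Vmod isArc} (r : Path c b) (hb : InPortionThree (isArc := isArc) v b) :
    InPortionThree (isArc := isArc) v c := by
  induction r with
  | nil => exact hb
  | cons r e ih => exact ih (inPortionThree_of_edge v e hb)

/-- `𝒩_{v'}` is not a vertex of the portion indexed by `v`. [cite: MochizukiAbsTopIII2015, Cor 5.5 p. 130] -/
theorem nv_not_mem_portion (v' : Vmod) : ¬ InPortionThree (isArc := isArc) v (.nv v') := by
  rintro (⟨-, hr⟩ | h)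
  · simp [DVertex.row] at hr
  · cases h

/-- **No arrow of `D•⊢` joins two `𝒩`'s**: a path `𝒩_v → 𝒩_{v'}` is the empty path (and `v = v'`).
[cite: MochizukiAbsTopIII2015, Cor 5.5 p. 129] -/
theorem eq_of_path_nv_nv {v v' : Vmod} (t : Path (DVertex.nv v : DVertex Vmod isArc) (.nv v')) :
    v = v' ∧ HEq t (Path.nil : Path (DVertex.nv v : DVertex Vmod isArc) (.nv v)) := by
  cases t with
  | nil => exact ⟨rfl, HEq.rfl⟩
  | cons t e =>
    cases e
    exact absurd (inPortionThree_of_path v' t (nplus_mem_portion v')) (nv_not_mem_portion v' v)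

/-- **`Γ⃗_{D•_{≤2} ∪ {𝒩⊞_v} ∪ {𝒩_v}} ↪ Γ⃗_{D•⊢}` is an embedding** (injective on vertices and arrows).
[cite: MochizukiAbsTopIII2015, Section 0 p.26] -/
theorem graphEmbedding_embExt_nv : GraphEmbedding (embExt (InPortionThree (isArc := isArc) v) (.nv v)) := by
  refine ⟨fun a b h => ?_, fun {a b} e e' h => ?_⟩
  · cases a with
    | base a =>
      cases b with
      | base b => exact congrArg ExtVertex.base (Subtype.ext h)
      | obs =>
        have h' : a.1 = DVertex.nv v := h
        have ha : InPortionThree (isArc := isArc) v (DVertex.nv v) := by rw [← h']; exact a.2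
        exact absurd ha (nv_not_mem_portion v v)
    | obs =>
      cases b with
      | base b =>
        have h' : DVertex.nv v = b.1 := h
        have hb : InPortionThree (isArc := isArc) v (DVertex.nv v) := by rw [h']; exact b.2
        exact absurd hb (nv_not_mem_portion v v)
      | obs => rfl
  · cases a with
    | base a =>
      cases b with
      | base b => exact h
      | obs => exact h
    | obs =>
      cases b with
      | base b => exact PEmpty.elim e
      | obs => exact PEmpty.elim e

/-- **… and a sieve**: every arrow of `D•⊢` into a vertex of the portion or into `𝒩_v` is an arrow of the presentation.
[cite: MochizukiAbsTopIII2015, Section 0 p.26] -/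
theorem isSieve_embExt_nv : IsSieve (embExt (InPortionThree (isArc := isArc) v) (.nv v)) := by
  intro c b' e
  cases b' with
  | base b =>
    exact ⟨ExtVertex.base ⟨c, inPortionThree_of_edge v e b.2⟩, e, rfl, HEq.rfl⟩
  | obs =>
    cases e
    exact ⟨ExtVertex.base ⟨.nplus v, nplus_mem_portion v⟩, DEdge.forget v, rfl, HEq.rfl⟩

end Graph

/-! ## §2. The relative-lift datum of the `TS`-observables at the pivots `𝒩_v` -/

section Datum

variable (Hts : ∀ v : Vmod, (L.logDiagramTS v).HomotopyFamily)

/-- The family `Hts v` read on `D•⊢` restricted along the embedding (abc-iut-f-102's identification `extend_eq_comapAlong` of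
the presentation `D•_{≤2} ∪ {𝒩⊞_v} ∪ {𝒩_v}` with the restriction of `D•⊢`). [cite: MochizukiAbsTopIII2015, Definition 3.5 (ii) p.75] -/
noncomputable def tsLiftFamily (v : Vmod) :
    (L.diagram.comapAlong (embExt (InPortionThree (isArc := isArc) v) (.nv v))).HomotopyFamily :=
  (L.extend_eq_comapAlong (InPortionThree v) (.nv v)) ▸ Hts v

/-- The pivots: the vertices `𝒩_v`. [cite: MochizukiAbsTopIII2015, Cor 5.5 (iii) p. 131] -/
def TSPivot (w : DVertex Vmod isArc) : Prop := ∃ v : Vmod, w = .nv v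

/-- The related pairs: at `𝒩_v`, abc-iut-L4-t5's lifting pairs of `Hts v` (pairs of paths of `D•⊢` into `𝒩_v` that are the
image of a boundary pair of `S_log_v`); nothing elsewhere. [cite: MochizukiAbsTopIII2015, Definition 3.5 (iii) p.75] -/
def tsRel : ∀ ⦃a w : DVertex Vmod isArc⦄, Path a w → Path a w → Prop
  | _, .nv v, P, Q => liftE (embExt (InPortionThree (isArc := isArc) v) (.nv v)) L.diagram (logShapeTS (isArc := isArc) v).obs
      (L.tsLiftFamily Hts v) P Q
  | _, _, _, _ => False

/-- At `𝒩_v` the relation IS abc-iut-L4-t5's `liftE`. [cite: MochizukiAbsTopIII2015, Definition 3.5 (iii) p.75] -/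
theorem tsRel_nv_iff (v : Vmod) {a : DVertex Vmod isArc} (P Q : Path a (.nv v)) :
    L.tsRel Hts P Q ↔
      liftE (embExt (InPortionThree (isArc := isArc) v) (.nv v)) L.diagram (logShapeTS (isArc := isArc) v).obs (L.tsLiftFamily Hts v) P Q :=
  Iff.rfl

/-- The homotopies: abc-iut-L4-t5's `liftη` (the homotopy of `S_log_v`, read on the path functors of `D•⊢`).
[cite: MochizukiAbsTopIII2015, Definition 3.5 (ii) p.75] -/
noncomputable def tsθ : ∀ ⦃a w : DVertex Vmod isArc⦄, TSPivot w → ∀ ⦃P Q : Path a w⦄, L.tsRel Hts P Q →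
    (L.diagram.pathFunctor P ⟶ L.diagram.pathFunctor Q)
  | _, .nv v, _, _, _, h => liftη (embExt (InPortionThree (isArc := isArc) v) (.nv v)) L.diagram (logShapeTS (isArc := isArc) v).obs
      (L.tsLiftFamily Hts v) h
  | _, .row1 _, _, _, _, h => False.elim h
  | _, .core, _, _, _, h => False.elim h
  | _, .nplus _, _, _, _, h => False.elim h
  | _, .e5, _, _, _, h => False.elim h
  | _, .an, _, _, _, h => False.elim h
  | _, .e7, _, _, _, h => False.elim h
  | _, .nmonoPlus _, _, _, _, h => False.elim h
  | _, .nmono _, _, _, _, h => False.elim h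
  | _, .emono5, _, _, _, h => False.elim h
  | _, .anMono, _, _, _, h => False.elim h
  | _, .emono7, _, _, _, h => False.elim h

/-- At `𝒩_v` the homotopy IS abc-iut-L4-t5's `liftη`. [cite: MochizukiAbsTopIII2015, Definition 3.5 (ii) p.75] -/
theorem tsθ_nv (v : Vmod) (hw : TSPivot (.nv v)) {a : DVertex Vmod isArc} {P Q : Path a (.nv v)} (h : L.tsRel Hts P Q) :
    L.tsθ Hts hw h =
      liftη (embExt (InPortionThree (isArc := isArc) v) (.nv v)) L.diagram (logShapeTS (isArc := isArc) v).obs (L.tsLiftFamily Hts v) h :=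
  rfl

/-- a related pair is a pair into some `𝒩_v` (bookkeeping for the laws). [cite: MochizukiAbsTopIII2015, Definition 3.5 (iii) p.75] -/
private theorem liftE_refl_left' {v : Vmod} {a : DVertex Vmod isArc} {P Q : Path a (.nv v)}
    (h : liftE (embExt (InPortionThree (isArc := isArc) v) (.nv v)) L.diagram (logShapeTS (isArc := isArc) v).obs (L.tsLiftFamily Hts v) P Q) :
    liftE (embExt (InPortionThree (isArc := isArc) v) (.nv v)) L.diagram (logShapeTS (isArc := isArc) v).obs (L.tsLiftFamily Hts v) P P := by
  obtain ⟨w⟩ := h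
  exact ⟨⟨w.src, w.left, w.left, (L.tsLiftFamily Hts v).isSaturated.refl_left w.mem, w.src_eq, w.left_heq, w.left_heq⟩⟩

/-- (symmetric bookkeeping). [cite: MochizukiAbsTopIII2015, Definition 3.5 (iii) p.75] -/
private theorem liftE_refl_right' {v : Vmod} {a : DVertex Vmod isArc} {P Q : Path a (.nv v)}
    (h : liftE (embExt (InPortionThree (isArc := isArc) v) (.nv v)) L.diagram (logShapeTS (isArc := isArc) v).obs (L.tsLiftFamily Hts v) P Q) :
    liftE (embExt (InPortionThree (isArc := isArc) v) (.nv v)) L.diagram (logShapeTS (isArc := isArc) v).obs (L.tsLiftFamily Hts v) Q Q := by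
  obtain ⟨w⟩ := h
  exact ⟨⟨w.src, w.right, w.right, (L.tsLiftFamily Hts v).isSaturated.refl_right w.mem, w.src_eq, w.right_heq,
    w.right_heq⟩⟩

/-- ★ **The relative-lift datum of the `TS`-observables on `D•⊢`** (Def 3.5 (ii), abc-iut-f-101's `RelLifts`): pivots the
`𝒩_v`; related pairs at `𝒩_v` the lifting pairs of `Hts v`; homotopies those of `Hts v` read on `D•⊢`.  Laws: identity /
composition / pre-whiskering are abc-iut-L4-t5's `liftη_self` / `lift_trans` / `lift_precomp` (the embedding is a sieve);
post-composition between pivots is vacuous (`eq_of_path_nv_nv`). [cite: MochizukiAbsTopIII2015, Definition 3.5 (ii) p.75] -/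
noncomputable def tsRelLifts : L.diagram.RelLifts where
  W := TSPivot
  Rel := L.tsRel Hts
  θ := L.tsθ Hts
  rel_refl_left := by
    rintro a w P Q ⟨v, rfl⟩ h
    exact L.liftE_refl_left' Hts h
  rel_refl_right := by
    rintro a w P Q ⟨v, rfl⟩ h
    exact L.liftE_refl_right' Hts h
  rel_trans := by
    rintro a w P Q R ⟨v, rfl⟩ h₁ h₂
    exact (lift_trans (graphEmbedding_embExt_nv v) h₁ h₂).1
  rel_precomp := by
    rintro c a w r P Q ⟨v, rfl⟩ h
    exact (lift_precomp (graphEmbedding_embExt_nv v) (isSieve_embExt_nv v) h r).1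
  rel_postcomp := by
    rintro a w w' P Q t ⟨v, rfl⟩ ⟨v', rfl⟩ h
    obtain ⟨rfl, ht⟩ := eq_of_path_nv_nv t
    cases ht
    exact h
  θ_self := by
    rintro a w ⟨v, rfl⟩ P h
    exact liftη_self (graphEmbedding_embExt_nv v) h
  θ_trans := by
    rintro a w ⟨v, rfl⟩ P Q R h₁ h₂ h₃
    obtain ⟨h₃', e⟩ := lift_trans (graphEmbedding_embExt_nv v) h₁ h₂
    exact e.symm
  θ_precomp_heq := by
    rintro c a w ⟨v, rfl⟩ r P Q h h'
    obtain ⟨h'', e⟩ := lift_precomp (graphEmbedding_embExt_nv v) (isSieve_embExt_nv v) h r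
    exact natTrans_heq_of_app_conj (L.diagram.pathFunctor_comp r P) (L.diagram.pathFunctor_comp r Q) (fun x => e x)
  θ_postcomp_heq := by
    rintro a w w' ⟨v, rfl⟩ ⟨v', rfl⟩ P Q t h h'
    obtain ⟨rfl, ht⟩ := eq_of_path_nv_nv t
    cases ht
    exact (heq_whiskerRight_of_eq_id _ (L.diagram.pathFunctor_nil _)).symm

/-- The pivots of the datum are the `𝒩_v`. [cite: MochizukiAbsTopIII2015, Cor 5.5 (iii) p. 131] -/
theorem tsRelLifts_W_iff (w : DVertex Vmod isArc) : (L.tsRelLifts Hts).W w ↔ ∃ v : Vmod, w = .nv v := Iff.rfl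

/-- `𝒩_v` is a pivot. [cite: MochizukiAbsTopIII2015, Cor 5.5 (iii) p. 131] -/
theorem tsRelLifts_W_nv (v : Vmod) : (L.tsRelLifts Hts).W (.nv v) := ⟨v, rfl⟩

/-- The related pairs at `𝒩_v` are the lifting pairs of `Hts v`. [cite: MochizukiAbsTopIII2015, Definition 3.5 (iii) p.75] -/
theorem tsRelLifts_rel_iff (v : Vmod) {a : DVertex Vmod isArc} (P Q : Path a (.nv v)) :
    (L.tsRelLifts Hts).Rel P Q ↔
      liftE (embExt (InPortionThree (isArc := isArc) v) (.nv v)) L.diagram (logShapeTS (isArc := isArc) v).obs (L.tsLiftFamily Hts v) P Q :=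
  Iff.rfl

/-- The homotopy of a related pair at `𝒩_v` is `liftη`. [cite: MochizukiAbsTopIII2015, Definition 3.5 (ii) p.75] -/
theorem tsRelLifts_θ_eq (v : Vmod) (hw : (L.tsRelLifts Hts).W (.nv v)) {a : DVertex Vmod isArc} {P Q : Path a (.nv v)}
    (h : (L.tsRelLifts Hts).Rel P Q) :
    (L.tsRelLifts Hts).θ hw h =
      liftη (embExt (InPortionThree (isArc := isArc) v) (.nv v)) L.diagram (logShapeTS (isArc := isArc) v).obs (L.tsLiftFamily Hts v) h :=
  rfl

/-- Only pairs INTO a pivot are related. [cite: MochizukiAbsTopIII2015, Definition 3.5 (iii) p.75] -/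
theorem tsRelLifts_W_of_rel {a w : DVertex Vmod isArc} {P Q : Path a w} (h : (L.tsRelLifts Hts).Rel P Q) :
    (L.tsRelLifts Hts).W w := by
  cases w <;> first | exact ⟨_, rfl⟩ | exact False.elim h

/-! ## §3. The boundary pairs of `S_log_v` are related at the pivot `𝒩_v`, with the same homotopy -/

/-- ★ **Every boundary pair of `Hts v`, read on `D•⊢`, is related at `𝒩_v`, and the datum's homotopy there IS the homotopy
of `Hts v`** (heterogeneously: the path functors agree along the embedding only propositionally) — the input of the
`CompatibleIn` clause of F-3081. [cite: MochizukiAbsTopIII2015, Cor 5.5 (iii) p. 131] -/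
theorem tsRelLifts_rel_of_mem (v : Vmod) {a' : (logShapeTS (isArc := isArc) v).Vertex}
    {p q : Path a' (logShapeTS (isArc := isArc) v).obs} (mem : (Hts v).E p q) :
    ∃ h : (L.tsRelLifts Hts).Rel ((embExt (InPortionThree (isArc := isArc) v) (.nv v)).mapPath p)
        ((embExt (InPortionThree (isArc := isArc) v) (.nv v)).mapPath q),
      HEq ((L.tsRelLifts Hts).θ (L.tsRelLifts_W_nv Hts v) h) ((Hts v).η mem) := by
  have mem' : (L.tsLiftFamily Hts v).E p q :=
    (HomotopyFamily.cast_E_iff (L.extend_eq_comapAlong (InPortionThree v) (.nv v)) (Hts v) p q).mpr mem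
  obtain ⟨h, e⟩ := liftη_ofMem (F := embExt (InPortionThree (isArc := isArc) v) (.nv v)) (D := L.diagram)
    (ω := (logShapeTS (isArc := isArc) v).obs) (K := L.tsLiftFamily Hts v) (graphEmbedding_embExt_nv v) mem'
  refine ⟨h, ?_⟩
  rw [tsRelLifts_θ_eq, e]
  exact (HomotopyFamily.heq_eqToHom_comp_comp_eqToHom _ _ _).trans
    (HomotopyFamily.cast_η_heq (L.extend_eq_comapAlong (InPortionThree v) (.nv v)) (Hts v) mem')

end Datum

end LogFrobeniusSetting

end Literature.AnabelianGeometry.AbsoluteAnabelian
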